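import Literature.AlgebraicGeometry.HodgeTheory.BettiUniverseHodgeRiemannPositive
import Literature.AlgebraicGeometry.HodgeTheory.BettiUniverseTracePairing
import Literature.AlgebraicGeometry.HodgeTheory.BettiUniverseTraceIntegral
import Literature.AlgebraicGeometry.HodgeTheory.ComplexConjugationHolds
import Literature.AlgebraicGeometry.HodgeTheory.HodgeFiltrationModelsReductionProofs
import Literature.AlgebraicGeometry.Motives.HodgeStructureWeilOperator
import HarnessLib

/-!
# K2Q brick C-Q (part 2): a cohomological self-map of finite order on `H²` of a surface with `p_g > 0` is an
# ISOMETRY of the trace form `tr(x ∪ y)`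

Cell `hodge-nonav`, prover seat `hodge-nonav-20241-p1` (g20); programme K2Q (crux `PowersHodgeOfQuaternionCommutators`,
stmt-HodgeConjecture-24191, route `Q8SymplecticPowers`; memo `PROGRAMME-K2Q-20241p1-g20.md`, brick C-Q). HELPER FILE
(`--supports stmt-HodgeConjecture-24191 --as helper`). Sorry-free; axioms standard.

The cruxes of route `Q8SymplecticPowers` type the quaternion deck pair `τ, j : X ⟶ X` only COHOMOLOGICALLY
(`(τ^*)⁴ = 1`, `(j^*)² = (τ^*)²`, `j^*τ^* = (τ^*)³j^*`, eigen-Hodge numbers) — unlike routes A ∕ B, whose deck clauses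
display `tr(σ^*x ∪ σ^*y) = tr(x ∪ y)`. The degree-2 ENGINE (`Q8CommutatorDegreeTwoCore`) and the symplectic invariant
theory need `τ^*`, `j^*` to be ISOMETRIES of `Q = tr ∘ cup`. This file DERIVES that from the typed data: for a smooth
projective surface `X`, a morphism `σ : X ⟶ X` with `(σ^*)^m = 1` on `H²(X; ℚ)` (`m > 0`) and `H^{2,0}(X) ≠ 0`:
`σ^*` is multiplicative and `H⁴(X; ℚ)` is a line, so `tr(σ^*x ∪ σ^*y) = d · tr(x ∪ y)` with `d ∈ ℚ` the scalar by which
`σ^*` acts on `H⁴`; complexifying and testing on `η ∪ η̄`, `0 ≠ η ∈ H^{2,0}` (Hodge–Riemann in bidegree `(2,0)`,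
`hodgeRiemann_two_zero_positive`: `tr_ℂ(η ∪ η̄) = κ t`, `t > 0`, and `σ^*_ℂ η ∈ H^{2,0} ∖ 0`) gives `d > 0` and
`d^m = 1`, hence `d = 1`.

* `tr_cup_pull_pull_of_pull_pow_eq_one` — `tr(σ^*x ∪ σ^*y) = tr(x ∪ y)` for all `x, y ∈ H²(X; ℚ)`.

Honest scope: linear-algebraic bookkeeping; nothing here says HC, HC_CM or HC_AV is proved.

References: C. Voisin, *Hodge Theory I* (2002), §6.3.2 Thm. 6.32 (Hodge–Riemann), §7.3.2, §11.1; A. Hatcher, *Algebraic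
Topology* (2002), §3.2 Prop. 3.10 (naturality of cup), §3.3 Thm. 3.26.
-/

set_option linter.dupNamespace false

noncomputable section

open scoped TensorProduct
open CategoryTheory
open Literature.AlgebraicGeometry.Motives Literature.AlgebraicGeometry.HodgeTheory
open Literature.AlgebraicGeometry.HodgeTheory.BettiUniverse
open Literature.AlgebraicGeometry.Motives.HodgeStructure

namespace Summit.HodgeConjecture.HodgeConjecture.Theorems.Q8SymplecticPowersDeckIsometry

variable {X : SchemeOver ℂ}

/-- Base change commutes with powers of an endomorphism. [folklore] -/
private theorem baseChange_pow {V : Type*} [AddCommGroup V] [Module ℚ V] (f : V →ₗ[ℚ] V) (k : ℕ) :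
    (f ^ k).baseChange ℂ = (f.baseChange ℂ) ^ k := by
  induction k with
  | zero => rw [pow_zero, pow_zero, Module.End.one_eq_id, Module.End.one_eq_id, LinearMap.baseChange_id]
  | succ k ih => rw [pow_succ, pow_succ, Module.End.mul_eq_comp, Module.End.mul_eq_comp,
      LinearMap.baseChange_comp, ih]

/-- `trC (c ⊗ w) = c · tr w`. [folklore] -/
private theorem trC_tmul' {n : ℕ} (hX : IsSmoothProjective n X) (k : ℕ) (c : ℂ) (w : bettiCohomology X k) :
    trC hX k (c ⊗ₜ[ℚ] w) = c * (tr hX k w : ℂ) := by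
  have h : c ⊗ₜ[ℚ] w = c • ((1 : ℂ) ⊗ₜ[ℚ] w) := by
    rw [TensorProduct.smul_tmul', smul_eq_mul, mul_one]
  rw [h, map_smul, trC_one_tmul, smul_eq_mul]

/-- **A cohomological self-map of finite order on `H²` of a surface with `H^{2,0} ≠ 0` is an isometry of the trace form.**
For a smooth projective surface `X`, a morphism `σ : X ⟶ X` with `(σ^*)^m = 1` on `H²(X(ℂ); ℚ)`, `m > 0`, and
`H^{2,0}(X) ≠ 0` (for the standard Hodge structure `hodge … hX 2`): `tr(σ^*x ∪ σ^*y) = tr(x ∪ y)` for all `x, y`.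
[cite: VoisinHodgeI2002, §6.3.2 Thm. 6.32 and §7.3.2] [cite: HatcherAT2002, §3.2 Prop. 3.10 and §3.3 Thm. 3.26] -/
theorem tr_cup_pull_pull_of_pull_pow_eq_one (hX : IsSmoothProjective 2 X) (σ : X ⟶ X) {m : ℕ} (hm : 0 < m)
    (hσ : pull σ 2 ^ m = 1) (hpg : (hodge exists_isReal_hodgeModel_holds hX 2).piece 2 0 ≠ ⊥)
    (x y : bettiCohomology X 2) :
    tr hX (2 + 2) (cup X 2 2 (pull σ 2 x) (pull σ 2 y)) = tr hX (2 + 2) (cup X 2 2 x y) := by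
  classical
  haveI := finite hX 2
  haveI := finite hX (2 * 2)
  set H := hodge exists_isReal_hodgeModel_holds hX 2 with hH
  -- ### the scalar `d` by which `σ^*` acts on the line `H⁴(X; ℚ)`
  have h1 : Module.finrank ℚ (bettiCohomology X (2 * 2)) = 1 := finrank_bettiCohomology_top hX
  set e : bettiCohomology X (2 * 2) := lineBasis hX (2 * 2) h1 0 with he
  have htre : tr hX (2 * 2) e = 1 := tr_lineBasis hX h1
  have hline : ∀ w : bettiCohomology X (2 * 2), w = tr hX (2 * 2) w • e := by
    intro w
    have hsum := (lineBasis hX (2 * 2) h1).sum_repr w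
    rw [Fin.sum_univ_one] at hsum
    rw [tr_of_finrank_eq_one hX h1, Module.Basis.coord_apply]
    exact hsum.symm
  set d : ℚ := tr hX (2 * 2) (pull σ (2 * 2) e) with hd
  have htr : ∀ w : bettiCohomology X (2 * 2), tr hX (2 * 2) (pull σ (2 * 2) w) = d * tr hX (2 * 2) w := by
    intro w
    conv_lhs => rw [hline w, map_smul, map_smul]
    rw [smul_eq_mul, mul_comm]
  -- ### `Q(σ^*x, σ^*y) = d · Q(x, y)` and its complexification
  have hQ : ∀ x y : bettiCohomology X 2,
      tr hX (2 + 2) (cup X 2 2 (pull σ 2 x) (pull σ 2 y)) = d * tr hX (2 + 2) (cup X 2 2 x y) := by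
    intro x y
    rw [← pull_cup]
    exact htr (cup X 2 2 x y)
  have hQC : ∀ a b : ℂ ⊗[ℚ] bettiCohomology X 2,
      trC hX 4 (LinearMap.BilinMap.baseChange ℂ (cup X 2 2) ((pull σ 2).baseChange ℂ a)
        ((pull σ 2).baseChange ℂ b)) =
      (d : ℂ) * trC hX 4 (LinearMap.BilinMap.baseChange ℂ (cup X 2 2) a b) := by
    intro a b
    induction a using TensorProduct.induction_on with
    | zero => simp only [map_zero, LinearMap.zero_apply, mul_zero]
    | add a₁ a₂ h₁ h₂ => simp only [map_add, LinearMap.add_apply, h₁, h₂, mul_add]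
    | tmul c x =>
      induction b using TensorProduct.induction_on with
      | zero => simp only [map_zero, mul_zero]
      | add b₁ b₂ h₁ h₂ => simp only [map_add, h₁, h₂, mul_add]
      | tmul c' y =>
        rw [LinearMap.baseChange_tmul, LinearMap.baseChange_tmul, LinearMap.BilinMap.baseChange_tmul,
          LinearMap.BilinMap.baseChange_tmul, trC_tmul' hX, trC_tmul' hX]
        have h4 : tr hX 4 (cup X 2 2 (pull σ 2 x) (pull σ 2 y)) = d * tr hX 4 (cup X 2 2 x y) := hQ x y
        rw [h4]
        push_cast
        ring
  -- ### `σ^*_ℂ` is injective and preserves `H^{2,0}`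
  let f : Hom H H := pullHodgeHom exists_isReal_hodgeModel_holds hodgePQ_independent_of_hodgeModel_holds hX hX σ 2
  have hf : f.toLinearMap = pull σ 2 := rfl
  have hinj : Function.Injective ((pull σ 2).baseChange ℂ) := by
    obtain ⟨k, rfl⟩ : ∃ k, m = k + 1 := ⟨m - 1, by omega⟩
    have hcomp : (pull σ 2 ^ k).baseChange ℂ ∘ₗ (pull σ 2).baseChange ℂ = LinearMap.id := by
      rw [← LinearMap.baseChange_comp, ← Module.End.mul_eq_comp, ← pow_succ, hσ, Module.End.one_eq_id,
        LinearMap.baseChange_id]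
    exact LinearMap.injective_of_comp_eq_id _ _ hcomp
  have hF : ∀ η ∈ H.piece 2 0, (pull σ 2).baseChange ℂ η ∈ H.piece 2 0 := by
    intro η hη
    have hη' : η ∈ H.piece 2 (((2 : ℕ) : ℤ) - 2) := by
      rwa [show ((2 : ℕ) : ℤ) - 2 = 0 by norm_num]
    have hproj : H.pieceProj 2 η = η := H.pieceProj_apply_of_mem hη'
    have hmem := H.pieceProj_mem 2 ((pull σ 2).baseChange ℂ η)
    rw [show ((2 : ℕ) : ℤ) - 2 = 0 by norm_num, ← hf, ← f.baseChange_pieceProj 2 η, hproj] at hmem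
    exact hmem
  -- ### Hodge–Riemann on a non-zero `(2,0)`-class: `d > 0` and `d ^ m = 1`
  obtain ⟨η, hη, hη0⟩ := Submodule.exists_mem_ne_zero_of_ne_bot hpg
  obtain ⟨κ, hκ, hHR⟩ := hodgeRiemann_two_zero_positive exists_isReal_hodgeModel_holds hX rfl
  have hηF : η ∈ H.F 2 := H.piece_le_F 2 0 hη
  obtain ⟨t, ht, hA⟩ := hHR η hηF hη0
  have hση0 : (pull σ 2).baseChange ℂ η ≠ 0 := fun h ↦ hη0 (hinj (by rw [h, map_zero]))
  obtain ⟨t', ht', hB⟩ := hHR _ (H.piece_le_F 2 0 (hF η hη)) hση0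
  -- `κ t' = d κ t`
  have hdt : (d : ℂ) * t = t' := by
    have h := hQC η (conj η)
    rw [← conj_baseChange, hB, hA, ← mul_assoc, mul_comm (d : ℂ) κ, mul_assoc] at h
    exact (mul_left_cancel₀ hκ h).symm
  have hd0 : 0 < d := by
    have hre : (d : ℝ) * t = t' := by exact_mod_cast hdt
    have : 0 < (d : ℝ) := by
      by_contra hle
      push Not at hle
      have : (d : ℝ) * t ≤ 0 := mul_nonpos_of_nonpos_of_nonneg hle ht.le
      linarith
    exact_mod_cast this
  -- `A = d^m A`, `A ≠ 0`
  have hiter : ∀ (k : ℕ) (a b : ℂ ⊗[ℚ] bettiCohomology X 2),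
      trC hX 4 (LinearMap.BilinMap.baseChange ℂ (cup X 2 2) (((pull σ 2).baseChange ℂ ^ k) a)
        (((pull σ 2).baseChange ℂ ^ k) b)) =
      (d : ℂ) ^ k * trC hX 4 (LinearMap.BilinMap.baseChange ℂ (cup X 2 2) a b) := by
    intro k
    induction k with
    | zero => intro a b; simp
    | succ k ih =>
      intro a b
      rw [pow_succ', Module.End.mul_apply, Module.End.mul_apply, hQC, ih, pow_succ']
      ring
  have hdm : d ^ m = 1 := by
    have h := hiter m η (conj η)
    rw [← baseChange_pow, hσ, Module.End.one_eq_id, LinearMap.baseChange_id, LinearMap.id_apply,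
      LinearMap.id_apply, hA] at h
    have hA0 : κ * (t : ℂ) ≠ 0 := mul_ne_zero hκ (by exact_mod_cast ht.ne')
    have h1 : ((d : ℂ) ^ m) = 1 := by
      have h' : (1 : ℂ) * (κ * t) = (d : ℂ) ^ m * (κ * t) := by rw [one_mul]; exact h
      exact (mul_right_cancel₀ hA0 h').symm
    exact_mod_cast h1
  have hd1 : d = 1 := (pow_eq_one_iff_of_nonneg hd0.le hm.ne').1 hdm
  rw [hQ, hd1, one_mul]

end Summit.HodgeConjecture.HodgeConjecture.Theorems.Q8SymplecticPowersDeckIsometry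

end
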